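import Mathlib
import Literature.AlgebraicGeometry.HodgeTheory.GysinKernelSplit
import Literature.AlgebraicGeometry.HodgeTheory.HodgeRiemannPolarizability
import Literature.AlgebraicGeometry.HodgeTheory.ComplexConjugationHolds
import Literature.NumberTheory.Transcendental.DeRhamTheoremMultiplicative
import HarnessLib

/-!
# PencilStepBelowMiddle

Topic `Literature/AlgebraicGeometry/HodgeTheory`. Named literature fact(s) relocated by the gate from `Summits/HodgeConjecture/HodgeConjecture/Theorems/LimitExtensionMiddleDivisorSupportSufficesOfPencilStep.lean`
(accept-time relocation of `[cite]`d propositions written inline in a Summits proposal; human ruling 2026-08-15).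
Sources: DecataldoMigliorini2009, Thomas2005Nodes.

* `Literature.AlgebraicGeometry.HodgeTheory.deCataldoMigliorini2009_mem_algebraicClasses_of_two_mul_le`

## Status: PROVED (2026-08-16, p123843) — `deCataldoMigliorini2009_mem_algebraicClasses_of_two_mul_le_holds` in `HodgeTheory/PencilStepBelowMiddleHolds`

The named fact below is DISCHARGED: `Literature.AlgebraicGeometry.HodgeTheory.deCataldoMigliorini2009_mem_algebraicClasses_of_two_mul_le_holds`
(module `Literature.AlgebraicGeometry.HodgeTheory.PencilStepBelowMiddleHolds`, accepted as p123843, axioms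
`propext`/`Classical.choice`/`Quot.sound`) is the verbatim specialisation of the UNCONDITIONAL theorem
`Literature.AlgebraicGeometry.HodgeTheory.mem_algebraicClasses_of_two_mul_le` (same module), which is
`mem_algebraicClasses_of_two_mul_le_of_spread_supports` (`PencilStepBelowMiddleOfVerdier`, p122900/p123644:
Lefschetz pencil `exists_goodPencil`, the hypothesis on the smooth members, vertical support lines
`exists_verticalSupportLines`, incidence-divisor descent `mem_algebraicClasses_of_pencil_spread`, hard
Lefschetz `eq_zero_of_cupProduct_complexGysin_one_eq_zero`, strong induction on `p`) fed with the discharged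
spreading leaf `spread_supports_over_projectiveLine_holds` (`SpreadSupportsOfSmoothFamily`, p123611). That
discharge file imports THIS module (for the proposition only), so this module is NO LONGER a stand-alone
deletion candidate: removing it removes a proved, cited fact and breaks `PencilStepBelowMiddleHolds`. The
generation-3 review note kept below for the record is SUPERSEDED in its finding 2 ("not provable in
`Literature/` now"), in its maintenance request (deletion), and in its advice to Literature seats; its
finding 1 (faithful, proved in print) and finding 3 (the Summits obligation stmt-HodgeConjecture-1083 has the
same body plus an unused antecedent, and now closes from `mem_algebraicClasses_of_two_mul_le`) stand. The
proposition itself is unchanged byte-for-byte (p105576).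

## Historical status note (review-split generation 3, 2026-08-16) — SUPERSEDED, see the status above

Former heading: "Status: MERGED BACK — dead module awaiting deletion (operator maintenance); do not attempt
`…_holds` here".

Review-split verdict, generations 1 (p108917), 2 (p110043) and 3 (this revision, 2026-08-16),
each with the sources open (arXiv:0711.1307v1 pp. 10–11: "Using a Lefschetz pencil we deal with `Hᵏ(X)`,
`k ≤ d − 1` […] Take `Hilb(X̃/ℙ¹)` […] Since `u^*` is injective in this range by Weak Lefschetz
[…] It follows that `u^* a` is algebraic"; arXiv:math/0212216 p. 4: "proceed by induction on `d`
(for fixed `k`) […] For `k < d/2`, we pick a generic pencil […] the relative Hilbert Scheme […]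
a degree `r` multisection […] by Lefschetz"). Findings:

1. FAITHFUL and PROVED IN PRINT — not misstated, not open (one implication: `k` is the
   cohomological degree `2p`, the pencil range `k ≤ d − 1` is `2p ≤ m`, "the case `d − 1` done" is
   the Hodge conjecture for all smooth projective `m`-folds in all codimensions, used on the
   members `X_t` in codimensions `p` and `p − 1`; `p = 0` is `algebraicClasses_zero`).
2. NOT PROVABLE IN `Literature/` now, and not by cutting it again (decompositions do not recurse,
   D-0027; no new named fact may be minted for it, D-0026): every printed proof runs through
   inputs this tree holds only as UNPROVED named facts or not at all — Lefschetz pencils / Bertini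
   (`exists_fiberNet_pencil_hyperplaneSections`, `exists_fiberNet_pencil_weakLefschetz`), the
   spreading of fibrewise algebraic classes through relative Hilbert schemes
   (`spread_algebraicClasses_over_projectiveLine`), purity / the Gysin kernel
   (`Deligne1974_ker_restrictCompl_eq_iSup_range_complexGysin`, reduced in `GysinKernelSplit*` to
   the mixed-Hodge package), the blow-up / projective-bundle formula (no carrier) — each of them
   apex-sized.
3. A DUPLICATE OBLIGATION: minus the unused antecedent "HC in codimension `p − 1` for
   `(m+1)`-folds" the statement is the body of the EXISTING Summits support item
   stmt-HodgeConjecture-1083 (`Summit.HodgeConjecture.HodgeConjecture.Theses.NodalSupport.PencilReduction`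
   = `….Theses.LinearSystemTorelli.PencilReduction`; the equivalence is the Summits theorem
   `pencilStep_iff_pencilReduction_body`, p108744), which has an active prover and Summits-side
   helper files (`Theorems/LinearSystemTorelliPencilReduction*`); a Literature discharge could only
   be a port of that Summits-side assembly, which can never be imported here
   (`import.summits-from-literature`).

Hence, by the tree's D-0026 precedents (`Motives/EtaleArtinSchreier`,
`HodgeTheory/LefschetzOneOneChernWeil`, `HodgeTheory/GysinFormalism`), MERGE BACK: the fact returns
to being the explicit pencil hypothesis of its consumers, to be supplied by the closing theorem of
stmt-HodgeConjecture-1083. THE MERGE IS MATERIALLY COMPLETE — each consumer already has an in-tree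
replacement that does not import this module (`pen : NodalSupport.PencilReduction`, definitionally
the verbatim pencil hypothesis; `h827 : Deligne1974_ker_pullback_eq_ker_pullback_resolution` and
`hpol : smoothProjective_hodgeStructure_isPolarizable` the two remaining named leaves):

* stmt-HodgeConjecture-10865 (`MiddleDivisorSupportSuffices`): in place of
  `middleDivisorSupportSuffices_of_leaves h827 hpol hpen` (`Theorems/…SufficesOfPencilStep`) use
  `middleDivisorSupportSuffices_of_facts (Deligne1974_ker_restrictCompl_eq_iSup_range_complexGysin_holds_of h827)
  (Voisin2025_hodgeClass_lift_complexGysin_holds_of exists_isReal_hodgeModel_holds (fun E _ _ _ ↦ exists_deRhamIsoFamily_holds E) hpol) pen`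
  (`Theorems/LimitExtensionMiddleDivisorSupportSuffices`, p100793);
* stmt-HodgeConjecture-10868 (`Assembly`): in place of `limitExtension_assembly_of_namedLeaves`
  (`Theorems/…AssemblyNamedLeaves`) use `limitExtension_assembly_of_fourLeaves h827 hpol hS pen`
  (`Theorems/LimitExtensionAssemblyFourLeaves`, p109590).

WHAT REMAINS is physical deletion only, which no seat can perform: `Summits/…/Theorems` files are
prover-only AND append-only (D-0016; rewriting an importer to drop the hypothesis bounces
`theorems.append-only`, as the fifth prover seat of stmt-HodgeConjecture-10868 found), and there is
no delete verb. OPERATOR (`--maintenance`): remove in one change this module together with its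
three importers — `Theorems/LimitExtensionMiddleDivisorSupportSufficesOfPencilStep` (p105612),
`Theorems/LimitExtensionMiddleDivisorSupportSufficesPencilStepIff` (p108744),
`Theorems/LimitExtensionAssemblyNamedLeaves` (p108033); as of 2026-08-16 nothing imports any of the
four and none of their declarations is referenced outside them (they are registered only as
`supports`/`closes` records of stmt-HodgeConjecture-10865/10868), so no closing path is lost. Until
then the `def` below stays byte-for-byte as accepted (p105576) so that the importers build.
Literature seats: do not attempt `…_holds` and do not re-vendor the pencil step; the results worth
vendoring or proving are its bounded classical inputs listed in 2., each in its own file with its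
own locator (Voisin, *Hodge Theory II*: §2.1.1 for the existence of Lefschetz pencils; §3.3.1 and
§10.2.1, proof of Thm. 10.19, for relative Hilbert schemes and the spreading of cycles over a
multisection).

IF A PROVE SEAT IS NEVERTHELESS OPENED ON THIS DECL (the debt census still sees an undischarged
`def` until the deletion happens): do not re-derive the above, and do not park on
`Deligne1974_ker_restrictCompl_eq_iSup_range_complexGysin` — that fact is a split PARENT, closed
in-tree modulo its child (`Deligne1974_ker_restrictCompl_eq_iSup_range_complexGysin_holds_of`,
`GysinKernelSplit`), and two successive parks on it were classified "no resolvable prerequisite",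
which is what opened review generation 3. The OPEN LEAVES of this tree that the printed proofs
consume are, in proof order: `exists_fiberNet_pencil_hyperplaneSections`
(`LefschetzPencilHyperplaneSections`; Lefschetz pencils with smooth total space, Bertini — Voisin II
§2.1.1; both proofs), `spread_supports_over_projectiveLine` and
`vertical_rigidity_supportedClasses_projectiveLine` (`SpreadAlgebraicClassesPencil`; relative
Hilbert schemes, Baire, multisections — Voisin II §3.3.1 and §10.2.1; both proofs), and for the
gluing of the spread cycle either the decomposition (19) of arXiv:0711.1307,
`Hᵏ(X̃) = g_* Hᵏ⁻²(X_t)(−1) ⊕ u^* Hᵏ(X)` for `k ≤ d − 1` (blow-up formula plus weak Lefschetz — no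
carrier in the tree, not even as a named fact), or, in the divisor-induction reading of
stmt-HodgeConjecture-1083, purity `Deligne1974_ker_pullback_eq_ker_pullback_resolution`
(`GysinKernelSplit`; Hodge III Prop. 8.2.7) with the Hodge-class lift
`Voisin2025_hodgeClass_lift_complexGysin` (`GysinHodgeClassLift`, conditional on
`smoothProjective_hodgeStructure_isPolarizable`). Take the first leaf if it is free and Bertini is
within budget; otherwise end
`blocked-on: Literature.AlgebraicGeometry.HodgeTheory.exists_fiberNet_pencil_hyperplaneSections`
(an event-park on a leaf, which is resolvable), never on the split parents
`Deligne1974_ker_restrictCompl_eq_iSup_range_complexGysin` / `spread_algebraicClasses_over_projectiveLine`.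
-/

namespace Literature.AlgebraicGeometry.HodgeTheory

open scoped Manifold
open Literature.AlgebraicGeometry.Motives Literature.AlgebraicGeometry.HodgeTheory

/-- **The Lefschetz-pencil step of the induction on the dimension** (de Cataldo–Migliorini 2009,
§4, proof of Prop. 4.5, second paragraph, arXiv:0711.1307v1 pp. 10–11: "We want to prove HC(`d`)
for every `d`. […] Assume we have done the case `d − 1`. […] Using a Lefschetz pencil we deal with
`Hᵏ(X)`, `k ≤ d − 1`. Here is how. Take a nice Lefschetz pencil `X ← X̃ → ℙ¹`. […] By induction
we have HC for `X_t` […] Take `Hilb(X̃/ℙ¹)`. It has a countable number of components. It follows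
that there is an irreducible component of it that maps onto `ℙ¹` and that it contains an
uncountable number of the `Z_t`'s […] Since `u^*` is injective in this range by Weak Lefschetz,
`β = N N₁ a + N N₂ ν L^{k/2}` […] The summand `g_* α` is algebraic by induction. It follows that
`u^* a` is algebraic and we are done"; the same step is Thomas 2005, proof of Prop. 2, case
`k < d/2`, arXiv:math/0212216 p. 4, by "induction on `d` (for fixed `k`)" with a generic pencil,
the relative Hilbert scheme and a multisection) — a THEOREM in print, one implication between
two algebraicity statements: **if on every smooth projective complex variety of dimension `m`
every rational class of Hodge type `(q, q)` in `H^{2q}` is algebraic (lies in `algebraicClasses`),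
then on every smooth projective complex variety `X` of dimension `m + 1` every rational class of
Hodge type `(p, p)` in `H²ᵖ(X(ℂ); ℂ)` of degree `2p ≤ m` (i.e. below the middle) lies in
`algebraicClasses X p`.** In the tree's vocabulary (`IsSmoothProjective`, `complexBetti`,
`IsRationalClass`, `IsOfHodgeType`, `algebraicClasses = Nᵖ H²ᵖ`); the hypothesis is the
algebraicity of rational Hodge classes in dimension `m` in all codimensions, as the printed
induction on the dimension supplies it (it is used on the smooth members `X_t` of the pencil, in
codimensions `p` and `p − 1`). For `p = 0` the conclusion is `algebraicClasses X 0 = ⊤`; for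
`m ≤ 2` it is at most Lefschetz `(1,1)` on threefolds.
[cite: DecataldoMigliorini2009, §4 proof of Prop. 4.5 (arXiv:0711.1307v1 pp. 10–11)]
[cite: Thomas2005Nodes, §2 proof of Prop. 2, case k < d/2 (arXiv:math/0212216 p. 4)]
[file AlgebraicGeometry/HodgeTheory/PencilStepBelowMiddle] -/
def deCataldoMigliorini2009_mem_algebraicClasses_of_two_mul_le : Prop :=
  ∀ ⦃m : ℕ⦄ ⦃X : SchemeOver ℂ⦄, IsSmoothProjective (m + 1) X →
    (∀ ⦃Y : SchemeOver ℂ⦄, IsSmoothProjective m Y → ∀ (q : ℕ) (c : complexBetti Y (2 * q)),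
      IsRationalClass c → IsOfHodgeType m Y (2 * q) q q c → c ∈ algebraicClasses Y q) →
    ∀ (p : ℕ) (c : complexBetti X (2 * p)), 2 * p ≤ m → IsRationalClass c →
      IsOfHodgeType (m + 1) X (2 * p) p p c → c ∈ algebraicClasses X p

end Literature.AlgebraicGeometry.HodgeTheory
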